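/-
Copyright: derived here (Resolution Observatory cell `pub-rosobs`, carver gen 50). AI-written Lean; AI review is
weaker than expert review.  Companion file of the cell's POLYNOMIAL weighted-centre model `W(f)`: the identity core
of engine 1's LC-A (B) and the assembled STEP 2 of LEMMA LC (THEOREM-LC-eng1-g33 §2 STEP 2 (A)+(B)).
Instrument — NOT a resolution theorem and NOT a statement about the invariant of [AbramovichTemkinWlodarczyk2024].
-/
import Literature.AlgebraicGeometry.Resolution.WeightedCentrePureCofactor
import Literature.AlgebraicGeometry.Resolution.WeightedCentreAdicFiltration
import HarnessLib

/-!
# Pure cofactor extraction, part (B): without pure terms off the slot `a₀` the isotropy equation forces `c^p·r_y = 0`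

Setting as in `WeightedCentrePureCofactor`: `k[σ][ε_ι] = MvPolynomial ι k[X]`, `char k = p`, a slot `a₀`, the linear form
`R = Σ_{y ∈ S} r_y ε_y` (`a₀ ∉ S`), and a substitution `θ` ("`Ψ`") with `θ(ε_{a₀}) = ε_{a₀} + c σ^j + q + m₁` (`σ^{j+1} ∣ q`,
`m₁` without constant coefficient) and `θ(ε_i) = ε_i + A_i` (`i ≠ a₀`).

* `coeff_single_eq_zero_of_mem_varsIdeal_sq` : an element of `(ε)²` has no degree-one monomial `ε_y`;
* `coeff_single_aeval_eq_zero_of_mem_sq` (**LC-A (B)**, "no purely shifted slot off `a₀`"): if `G₀ ∈ (ε')²`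
  (`ε' = (ε_i)_{i ≠ a₀}`; every monomial of `G₀` has at least two variables, none of them `ε_{a₀}`) and the shifts
  `A_i` (`i ≠ a₀`) have NO PURE TERM (`A_i ∈ (ε)`), then `G₀(θ(ε))` has no monomial `σ^s·ε_y` at all: each of the `≥ 2`
  factors `ε_i + A_i` lies in `(ε)`;
* `pureCofactor_mul_eq_zero_of_aeval_eq` (**STEP 2 assembled**): if moreover `A_i ≡ 0 (mod σ)` and
  `G := G₀ + ε_{a₀}^p·R` satisfies the isotropy equation `G(θ(ε)) = G`, then `c^p · r_y = 0` for every `y ∈ S`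
  (coefficient of `σ^{pj}·ε_y`: part (A) `coeff_pureCofactor` gives `c^p r_y` from the second summand, part (B) gives `0`
  from the first, and `G` itself has no such monomial); over a field with `c ≠ 0`: every `r_y = 0`
  (`linearCofactor_eq_zero_of_aeval_eq`) — contradicting the pin condition `(1)` of THEOREM-LC STEP 1, whence LC-A:
  "a second purely shifted class exists".

[ATW24] Abramovich–Temkin–Włodarczyk, Algebra & Number Theory 18 (2024), Thm. 5.3.1 (2)–(3) (p. 1578).  CONTEXT ONLY;
the identities are elementary and ours.
-/

namespace Literature.AlgebraicGeometry.Resolution.WeightedBlowup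

open MvPolynomial
open scoped Polynomial

section NoPure

variable {R : Type*} [CommRing R] {ι : Type*} [DecidableEq ι]

omit [DecidableEq ι] in
/-- Elements of the ideal `(ε) = span {ε_i}` have zero constant coefficient (ours).
[cite: AbramovichTemkinWlodarczyk2024, Thm. 5.3.1 (2)–(3) (p. 1578)] -/
theorem constantCoeff_eq_zero_of_mem_varsIdeal {f : MvPolynomial ι R}
    (hf : f ∈ Ideal.span (Set.range (X : ι → MvPolynomial ι R))) : constantCoeff f = 0 := by
  have hle : Ideal.span (Set.range (X : ι → MvPolynomial ι R)) ≤ RingHom.ker constantCoeff :=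
    Ideal.span_le.mpr (by rintro _ ⟨i, rfl⟩; rw [SetLike.mem_coe, RingHom.mem_ker, constantCoeff_X])
  exact (RingHom.mem_ker).mp (hle hf)

/-- An element of `(ε)²` has no degree-one monomial (ours). [cite: AbramovichTemkinWlodarczyk2024, Thm. 5.3.1 (2)–(3) (p. 1578)] -/
theorem coeff_single_eq_zero_of_mem_varsIdeal_sq (y : ι) {f : MvPolynomial ι R}
    (hf : f ∈ Ideal.span (Set.range (X : ι → MvPolynomial ι R)) ^ 2) : coeff (Finsupp.single y 1) f = 0 := by
  rw [pow_two] at hf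
  refine Submodule.mul_induction_on hf (fun a ha b hb => ?_) (fun a b ha hb => by rw [coeff_add, ha, hb, add_zero])
  exact coeff_single_mul_of_constantCoeff y (constantCoeff_eq_zero_of_mem_varsIdeal ha)
    (constantCoeff_eq_zero_of_mem_varsIdeal hb)

/-- … nor has an element of `(ε)ⁿ`, `n ≥ 2` (ours). [cite: AbramovichTemkinWlodarczyk2024, Thm. 5.3.1 (2)–(3) (p. 1578)] -/
theorem coeff_single_eq_zero_of_mem_varsIdeal_pow (y : ι) {n : ℕ} (hn : 2 ≤ n) {f : MvPolynomial ι R}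
    (hf : f ∈ Ideal.span (Set.range (X : ι → MvPolynomial ι R)) ^ n) : coeff (Finsupp.single y 1) f = 0 :=
  coeff_single_eq_zero_of_mem_varsIdeal_sq y (Ideal.pow_le_pow_right hn hf)

/-- A ring map sending an ideal `J` into an ideal `I` sends `Jⁿ` into `Iⁿ` (elementary; ours).
[cite: AbramovichTemkinWlodarczyk2024, Thm. 5.3.1 (2)–(3) (p. 1578)] -/
theorem map_mem_pow_of_map_le {S T : Type*} [CommRing S] [CommRing T] {F : Type*} [FunLike F S T]
    [RingHomClass F S T] (ψ : F) {J : Ideal S} {I : Ideal T} (h : J.map ψ ≤ I) {n : ℕ} {x : S} (hx : x ∈ J ^ n) :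
    ψ x ∈ I ^ n := by
  have hx' := Ideal.mem_map_of_mem ψ hx
  rw [Ideal.map_pow] at hx'
  exact Ideal.pow_right_mono h n hx'

/-- **LC-A (B)** (no purely shifted slot off `a₀`; ours).  If `G₀ ∈ (ε')²` with `ε' = (ε_i)_{i ≠ a₀}` and the
substitution `θ` satisfies `θ(ε_i) ∈ (ε)` for every `i ≠ a₀` (i.e. `θ(ε_i) = ε_i + A_i` with `A_i` WITHOUT pure term), then
`G₀(θ(ε))` lies in `(ε)²` and has no degree-one monomial `ε_y` — whatever `θ(ε_{a₀})` is.
[cite: AbramovichTemkinWlodarczyk2024, Thm. 5.3.1 (2)–(3) (p. 1578)] -/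
theorem coeff_single_aeval_eq_zero_of_mem_sq (a₀ : ι) (θ : ι → MvPolynomial ι R)
    (hθ : ∀ i, i ≠ a₀ → θ i ∈ Ideal.span (Set.range (X : ι → MvPolynomial ι R))) {G₀ : MvPolynomial ι R}
    (hG₀ : G₀ ∈ Ideal.span ((X : ι → MvPolynomial ι R) '' {i | i ≠ a₀}) ^ 2) (y : ι) :
    coeff (Finsupp.single y 1) (aeval θ G₀) = 0 := by
  refine coeff_single_eq_zero_of_mem_varsIdeal_sq y (map_mem_pow_of_map_le (aeval θ) ?_ hG₀)
  rw [Ideal.map_span, Ideal.span_le]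
  rintro _ ⟨_, ⟨i, hi, rfl⟩, rfl⟩
  show aeval θ (X i) ∈ _
  rw [aeval_X]
  exact hθ i hi

end NoPure

section Assembled

variable {k : Type*} [CommRing k] (p : ℕ) [hp : Fact p.Prime] [CharP k p] {ι : Type*} [DecidableEq ι]

/-- **LEMMA LC, STEP 2 assembled** (LC-A (A)+(B); ours).  `G = G₀ + ε_{a₀}^p·R` with `R = Σ_{y ∈ S} r_y ε_y`
(`a₀ ∉ S`), `G₀ ∈ (ε')²`; the substitution `θ(ε_{a₀}) = ε_{a₀} + c σ^j + q + m₁` (`σ^{j+1} ∣ q`, `m₁` without constant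
coefficient), `θ(ε_i) = ε_i + A_i` (`i ≠ a₀`) with `A_i ∈ (ε)` (no pure term off `a₀`) and `A_i ≡ 0 (mod σ)`.  If
`G(θ(ε)) = G` then `c^p · r_y = 0` for every `y ∈ S`. [cite: AbramovichTemkinWlodarczyk2024, Thm. 5.3.1 (2)–(3) (p. 1578)] -/
theorem pureCofactor_mul_eq_zero_of_aeval_eq (a₀ : ι) (S : Finset ι) (hS : a₀ ∉ S) (r : ι → k) (c : k) (j : ℕ)
    (q : k[X]) (hq : Polynomial.X ^ (j + 1) ∣ q) (m₁ : MvPolynomial ι k[X]) (hm₁ : constantCoeff m₁ = 0)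
    (A : ι → MvPolynomial ι k[X]) (hA : ∀ i, i ≠ a₀ → A i ∈ Ideal.span (Set.range (X : ι → MvPolynomial ι k[X])))
    (hAσ : ∀ i d, ((A i).coeff d).coeff 0 = 0) (θ : ι → MvPolynomial ι k[X])
    (hθ₀ : θ a₀ = X a₀ + (C (Polynomial.C c * Polynomial.X ^ j + q) + m₁)) (hθ : ∀ i, i ≠ a₀ → θ i = X i + A i)
    {G₀ : MvPolynomial ι k[X]} (hG₀ : G₀ ∈ Ideal.span ((X : ι → MvPolynomial ι k[X]) '' {i | i ≠ a₀}) ^ 2)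
    (hiso : aeval θ (G₀ + X a₀ ^ p * ∑ y' ∈ S, C (Polynomial.C (r y')) * X y')
      = G₀ + X a₀ ^ p * ∑ y' ∈ S, C (Polynomial.C (r y')) * X y') {y : ι} (hy : y ∈ S) :
    c ^ p * r y = 0 := by
  have hX : ∀ i, (X i : MvPolynomial ι k[X]) ∈ Ideal.span (Set.range (X : ι → MvPolynomial ι k[X])) :=
    fun i => Ideal.subset_span ⟨i, rfl⟩
  -- the substituted second summand is `(ε_{a₀} + m)^p · Σ r_{y'} (ε_{y'} + A_{y'})`
  have hsub : aeval θ (X a₀ ^ p * ∑ y' ∈ S, C (Polynomial.C (r y')) * X y')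
      = (X a₀ + (C (Polynomial.C c * Polynomial.X ^ j + q) + m₁)) ^ p
          * ∑ y' ∈ S, C (Polynomial.C (r y')) * (X y' + A y') := by
    rw [map_mul, map_pow, aeval_X, hθ₀, map_sum]
    congr 1
    refine Finset.sum_congr rfl fun y' hy' => ?_
    rw [map_mul, aeval_C, aeval_X, hθ y' (fun h => hS (h ▸ hy')), MvPolynomial.algebraMap_eq]
  -- compare the coefficients of `σ^{pj}·ε_y`
  have key := congrArg (fun F : MvPolynomial ι k[X] => (coeff (Finsupp.single y 1) F).coeff (p * j)) hiso
  simp only [map_add, coeff_add, Polynomial.coeff_add] at key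
  rw [hsub, coeff_pureCofactor p a₀ S r c j q hq m₁ hm₁ A hAσ hy,
    coeff_single_aeval_eq_zero_of_mem_sq a₀ θ (fun i hi => by rw [hθ i hi]; exact Ideal.add_mem _ (hX i) (hA i hi))
      hG₀ y,
    coeff_single_X_pow_mul a₀ y hp.out.two_le, Polynomial.coeff_zero, zero_add, add_zero] at key
  -- `G₀` itself has no monomial `ε_y`: `(ε')² ⊆ (ε)²`
  have hG₀' : G₀ ∈ Ideal.span (Set.range (X : ι → MvPolynomial ι k[X])) ^ 2 :=
    Ideal.pow_right_mono (Ideal.span_mono (by rintro _ ⟨i, _, rfl⟩; exact ⟨i, rfl⟩)) 2 hG₀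
  rw [coeff_single_eq_zero_of_mem_varsIdeal_sq y hG₀', Polynomial.coeff_zero] at key
  exact key

/-- Over a field (or a domain) with `c ≠ 0`: under the hypotheses of `pureCofactor_mul_eq_zero_of_aeval_eq` every
cofactor coefficient `r_y` vanishes — the negation of the pin condition of THEOREM-LC STEP 1, i.e. LC-A (ours).
[cite: AbramovichTemkinWlodarczyk2024, Thm. 5.3.1 (2)–(3) (p. 1578)] -/
theorem linearCofactor_eq_zero_of_aeval_eq [IsDomain k] (a₀ : ι) (S : Finset ι) (hS : a₀ ∉ S) (r : ι → k) {c : k}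
    (hc : c ≠ 0) (j : ℕ) (q : k[X]) (hq : Polynomial.X ^ (j + 1) ∣ q) (m₁ : MvPolynomial ι k[X])
    (hm₁ : constantCoeff m₁ = 0) (A : ι → MvPolynomial ι k[X])
    (hA : ∀ i, i ≠ a₀ → A i ∈ Ideal.span (Set.range (X : ι → MvPolynomial ι k[X])))
    (hAσ : ∀ i d, ((A i).coeff d).coeff 0 = 0) (θ : ι → MvPolynomial ι k[X])
    (hθ₀ : θ a₀ = X a₀ + (C (Polynomial.C c * Polynomial.X ^ j + q) + m₁)) (hθ : ∀ i, i ≠ a₀ → θ i = X i + A i)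
    {G₀ : MvPolynomial ι k[X]} (hG₀ : G₀ ∈ Ideal.span ((X : ι → MvPolynomial ι k[X]) '' {i | i ≠ a₀}) ^ 2)
    (hiso : aeval θ (G₀ + X a₀ ^ p * ∑ y' ∈ S, C (Polynomial.C (r y')) * X y')
      = G₀ + X a₀ ^ p * ∑ y' ∈ S, C (Polynomial.C (r y')) * X y') {y : ι} (hy : y ∈ S) : r y = 0 :=
  (mul_eq_zero.mp (pureCofactor_mul_eq_zero_of_aeval_eq p a₀ S hS r c j q hq m₁ hm₁ A hA hAσ θ hθ₀ hθ hG₀ hiso hy)).resolve_left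
    (pow_ne_zero p hc)

end Assembled

end Literature.AlgebraicGeometry.Resolution.WeightedBlowup
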